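import Summits.CriticalPhenomena.PercolationContinuityZ3.Theorems.PercNearOneGluingNoHeavyQuantTwoBlobGateCell
import Summits.CriticalPhenomena.PercolationContinuityZ3.Theorems.PercNearOneGluingNoHeavyQuantFlowPieces
import Summits.CriticalPhenomena.PercolationContinuityZ3.Theorems.PercNearOneGluingNoHeavyQuantSDEC
import HarnessLib

/-!
# QUANT lane R8, T-DEC: THE SHAPE OF THE SINGLE-GATE CLOSURE, part 1 — the single-low branch of the gated convolution is the first-moment
# criterion (kernel, unconditional; part 2 `…QuantSingleGateConeRefutation`: the cone form is false)

builds on p205010 (kernel theorem, internal audit signed; external expert review pending)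

Support file (`--supports stmt-CriticalPhenomena-4575`), QUANT lane lead seat prim-quant-lead (gen 28), rung R8 of
`run/shared/lean/prim/quant/LADDER.md`.  Part 1 of 2: one theorem, no definitions, standard axioms, no sorries.  Companion of `…QuantSingleGateClosure`
(lead g28: `@[conjecture] LawDec.SingleGateConvClosed` — for ONE gate `q`, `gate_q μᵢ` top-affordable and DEC at all layers at floor `y` ⟹
`gate_q(μ₁ ∗ μ₂)` DEC at all layers at `y` — and its kernel reductions to `SDECConvClosed` / `FarTreeRow`); LEAD-NOTES-G28 N80, N85.

(1) **`LawDec.decAtT_gate_lconv_singleLow`** — if the atom `0` is the ONLY low of the gated convolution `gate_q(μ₁ ∗ μ₂)` at `(t, j)`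
(`t = q·(T₁ + T₂)` its mean; no charged atom `1 ≤ k ≤ j` with `2k < t`) and the gated factors are top-affordable at `y` (`y·Mᵢ ≤ q·Tᵢ`), then
`gate_q(μ₁ ∗ μ₂)` is `DECAtT y t j (M₁ + M₂)` — by typer g26's first-moment criterion `flowAtT_of_moment` (the gated convolution is
top-affordable at `y` and has mean `t`).  This is the single-low branch of `SingleGateConvClosed` (and of PM⁻ / arm-1 g38's route: lead g28 N80,
1 368 exact LPs — the zero-direction SDEC rows are never used); it needs NO hypothesis on the factors beyond top-affordability.

(2) **`LawDec.not_gatedConv_coneForm`** — the cone form of the gated closure (free targets above the mean, ConvClosedT-style windows including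
the layers at and above the factors' tops, top-affordability w.r.t. the targets) is FALSE for `q < 1`: with `y = 7/12`, `q = 3/4`,
`μ₁ = {3: 4/9, 4: 5/9}` (`gate_q μ₁ = {0: 1/4, 3: 1/3, 4: 5/12}`, target `T₁ = 8/3` = its mean) and `μ₂ = {1: 1/2, 3: 1/2}` (`gate_q μ₂ =
{0: 1/4, 1: 3/8, 3: 3/8}`, target `T₂ = 7/4` = its mean `3/2` PLUS `1/4`, certified at every layer of the window only because the atom `1` is
point-self-sufficient, `2·1 ≥ 7/4`), at `j = 6`: every window hypothesis holds (`DECAtT` of `gate_q μ₁` at layers `3..6`, of `gate_q μ₂` at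
layers `2..6`, all single-low capacity inequalities, two of them tight) but `gate_q(μ₁ ∗ μ₂) = {0: 1/4, 4: 1/6, 5: 5/24, 6: 1/6, 7: 5/24}` is NOT
`DECAtT (7/12) (8/3 + 7/4) 6 7` (single-low capacity `1051/3180 < 1113/3180`), although it IS DEC at its mean `25/6` at every layer.  So the
target surplus that point self-sufficiency buys does not pass through a common gate: `SingleGateConvClosed` must be (and is) stated AT THE
MEANS; census (lead g28 exp12b, both factors boundary-pushed): targets at/below the means 8 435 / 0, above 4 / 3 581; the `q = 1` cone form
(`ConvClosedT`) is unaffected (2 500 / 0 with and without the TA cap).  All verdicts by typer g23's `decAtT_singleLow_iff` + the closed forms of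
`capCoef` (arm-1 g38 `capCoef0_eq_heavy`, arm-2 g31 `capCoef_giant` / `capCoef_zero_mid_incompat`).

[this work]; nothing here is cited as a published result.  The gluing rows served [cite: KozmaNitzan2024, Conjecture 3 (p. 15)]; product
measure [cite: Grimmett1999, §1.3 p. 10].
-/

noncomputable section

namespace Summit.CriticalPhenomena.PercolationContinuityZ3.Theorems

namespace Quant

open Finset

namespace LawDec

/-! ### (1) The single-low branch of the gated convolution -/

/-- **The single-low branch of the single-gate closure.**  For `0 < y < 1`, `0 < q ≤ 1`, probability laws `μ₁` on `{0..M₁}`, `μ₂` on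
`{0..M₂}` whose gated versions are top-affordable at `y` (`y·Mᵢ ≤ q·Tᵢ`, `Tᵢ` the means): if no atom `1 ≤ k ≤ j` with `2k < q(T₁+T₂)` is charged
by `gate_q(μ₁ ∗ μ₂)`, then `gate_q(μ₁ ∗ μ₂)` is `DECAtT y (q(T₁+T₂)) j (M₁+M₂)` — the first-moment criterion `flowAtT_of_moment`. [this work] -/
theorem decAtT_gate_lconv_singleLow (y q : ℝ) (M₁ M₂ j : ℕ) (μ₁ μ₂ : ℕ → ℝ)
    (hy0 : 0 < y) (hy1 : y < 1) (hq0 : 0 < q) (hq1 : q ≤ 1)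
    (h10 : ∀ h, 0 ≤ μ₁ h) (h11 : ∑ h ∈ Finset.range (M₁ + 1), μ₁ h = 1)
    (hta1 : y * (M₁ : ℝ) ≤ q * ∑ h ∈ Finset.range (M₁ + 1), (h : ℝ) * μ₁ h)
    (h20 : ∀ h, 0 ≤ μ₂ h) (h21 : ∑ h ∈ Finset.range (M₂ + 1), μ₂ h = 1)
    (hta2 : y * (M₂ : ℝ) ≤ q * ∑ h ∈ Finset.range (M₂ + 1), (h : ℝ) * μ₂ h)
    (hsingle : ∀ k, 1 ≤ k → k ≤ j →
      2 * (k : ℝ) < q * (∑ h ∈ Finset.range (M₁ + 1), (h : ℝ) * μ₁ h + ∑ h ∈ Finset.range (M₂ + 1), (h : ℝ) * μ₂ h) →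
      gate (lconv M₁ M₂ μ₁ μ₂) q k = 0) :
    DECAtT y (q * (∑ h ∈ Finset.range (M₁ + 1), (h : ℝ) * μ₁ h + ∑ h ∈ Finset.range (M₂ + 1), (h : ℝ) * μ₂ h)) j (M₁ + M₂)
      (gate (lconv M₁ M₂ μ₁ μ₂) q) := by
  set T : ℝ := q * (∑ h ∈ Finset.range (M₁ + 1), (h : ℝ) * μ₁ h + ∑ h ∈ Finset.range (M₂ + 1), (h : ℝ) * μ₂ h) with hT
  set A : ℕ → ℝ := gate (lconv M₁ M₂ μ₁ μ₂) q with hA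
  -- law facts of the gated convolution
  have hA0 : ∀ h, 0 ≤ A h := fun h => by
    simp only [hA, gate]
    have := lconv_nonneg M₁ M₂ μ₁ μ₂ h10 h20 h
    split_ifs <;> nlinarith
  have hAM : ∀ h, M₁ + M₂ < h → A h = 0 := fun h hh => by
    simp only [hA, gate]
    rw [lconv_eq_zero M₁ M₂ μ₁ μ₂ h hh, if_neg (by omega)]; ring
  have hA1 : ∑ h ∈ Finset.range (M₁ + M₂ + 1), A h = 1 :=
    sum_gate _ q (M₁ + M₂) (sum_lconv M₁ M₂ μ₁ μ₂ h11 h21)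
  have hAmean : ∑ h ∈ Finset.range (M₁ + M₂ + 1), (h : ℝ) * A h = T := by
    rw [hA, sum_mul_gate, sum_mul_lconv M₁ M₂ μ₁ μ₂ h11 h21]
  -- positivity of the target: `y·(M₁+M₂) ≤ T` and, if `M₁ + M₂ = 0`, there is nothing to decide… we treat `T ≤ 0` separately
  have hta : y * ((M₁ + M₂ : ℕ) : ℝ) ≤ T := by
    rw [Nat.cast_add, mul_add, hT, mul_add]; exact add_le_add hta1 hta2
  by_cases hTpos : 0 < T
  · refine decAtT_of_flowAtT y T j (M₁ + M₂) A hy0 hy1 hAM hA1 ?_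
    refine flowAtT_of_moment y T j (M₁ + M₂) A hy0 hy1 hTpos hA0 ?_ hta ?_
    · intro l hl1 hlj hlow
      exact hsingle l hl1 hlj hlow
    · rw [hA1, hAmean, mul_one]
  · -- `T ≤ 0`: then `y·(M₁+M₂) ≤ 0` forces `M₁ + M₂ = 0`, the law is `δ₀`, a self-sufficient point (`T ≤ 2·0`)
    have hT0 : T ≤ 0 := not_lt.1 hTpos
    have hMM : M₁ + M₂ = 0 := by
      by_contra hne
      have : (1 : ℝ) ≤ ((M₁ + M₂ : ℕ) : ℝ) := by exact_mod_cast Nat.one_le_iff_ne_zero.2 hne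
      nlinarith
    have hA00 : A 0 = 1 := by simpa [hMM] using hA1
    refine ⟨Unit, inferInstance, fun _ => 1, fun _ => 0, fun _ => 0, fun _ => 0, fun _ => zero_le_one, by simp,
      fun _ => ⟨le_rfl, zero_le_one⟩, fun _ => le_rfl, fun _ => Nat.zero_le _, fun h => ?_, fun _ _ => ?_⟩
    · simp only [Finset.sum_const, Finset.card_univ, Fintype.card_unit, one_smul, zero_mul, zero_add, sub_zero, one_mul]
      by_cases hh : h = 0
      · subst hh; simp [hA00]
      · rw [if_neg hh]
        exact hAM h (by omega)
    · exact Or.inl ⟨rfl, Or.inl (by simp; linarith)⟩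

end LawDec

end Quant

end Summit.CriticalPhenomena.PercolationContinuityZ3.Theorems
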